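import Summits.NavierStokesRegularity.NavierStokesRegularity.Theorems.ScenarioCensusRowF1Equilibrium
import Summits.NavierStokesRegularity.NavierStokesRegularity.Theorems.ScenarioCensusRowF1FrozenTop
import HarnessLib

/-!
# LINE «equilibrium-top» port, part 2/4: §3 the `M`-normalised singular Type-I zoom package with Hessians; §4 THE KILL — weak Eulerian equilibrium on every slice ⇒ `W ≡ 0`
# (the weak time-rigidity chain, taken BY NAME from the frozen-top port which re-proved it verbatim); §5 the joint compactness engine for weight-3 read-outs

Re-homed for the scenario census (typer seat ns-census-typer-1 g8; the cells F1eqq / F1bnq and the o-forms F1eq / F1bn are MEMBERS OF RECORD «DECIDED IN KERNEL IN FILES» of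
row F1 since census v1.71 (critic idea-crit-3 PASS; ref ns-census-ref g8 PRE-CHECK ✓; lead-presearch label); this port makes them TREE-decided): VERBATIM PORT of ns-idea-3
LINE 19 «equilibrium-top», `pub/ideators/ns-idea-3/lines/equilibrium-top/line-equilibrium-top.lean` sha16 a530d660993acd54 (1664 l., lean check rc 0, 0 sorry), split
for the 400-line rule into `ScenarioCensusRowF1Equilibrium` (§1–§2) → `…EquilibriumKill` (§3–§5) → `…EquilibriumTransfer` (§6) → `…EquilibriumTop` (§7 + census KEYS).
Lean text VERBATIM in namespace `…Theorems.ScenarioCensus.EquilibriumTop` (the line's `…Cruxes.ScenarioCensusRowF1.EquilibriumTopLine` re-homed); port edits: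
`@[conjecture]` on the residual `DriveDefectSlack` (≡ `ScenarioCensus.Row_F1`, OPEN), one-line docstrings added where missing (gate lint); the lemmas the line shares
VERBATIM with the landed inviscid-top / frozen-top / columnar-top / stretched-top ports — including the §4 weak time-rigidity chain `cp` … `eq_zero_of_frozenVorticity`,
which the frozen-top port carries verbatim (and with it the one use of `Literature.Analysis.FunctionSpaces.WeakTimeDerivativeClassical`) — are taken BY NAME (listed
below); the line's direct WTDC import is therefore not needed here.  Statements untouched.

No census VALUE is moved here (row F1 stays OPEN-WITH-LINE; the members become TREE-decided by name); NS regularity is NOT proved; `Row_F1` is untouched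
(zero movement, `driveDefectSlack_iff_rowF1`); no summit statement is proved by this file. Lemmas that restate already-landed tree declarations are taken BY NAME (gate lint `dedup.landed`): `fderiv_smul_stPull_apply` = `InviscidTop.fderiv_smul_stPull_apply`, `fderiv_smul_stPull` = `InviscidTop.fderiv_smul_stPull`, `fderiv_fderiv_smul_stPull` = `InviscidTop.fderiv_fderiv_smul_stPull`, `fderiv_fderiv_zoom` = `InviscidTop.fderiv_fderiv_zoom`, `tendsto_clm_of_tendsto_apply` = `InviscidTop.tendsto_clm_of_tendsto_apply`, `tendsto_fderiv_fderiv_apply_of_bound` = `InviscidTop.tendsto_fderiv_fderiv_apply_of_bound`, `tendsto_fderiv_fderiv_of_bound` = `InviscidTop.tendsto_fderiv_fderiv_of_bound`, `tendsto_fderiv_fderiv_of_typeI_seq_Ioo` = `InviscidTop.tendsto_fderiv_fderiv_of_typeI_seq_Ioo`, `tendsto_fderiv_fderiv_of_isTypeIAncientMild_seq` = `InviscidTop.tendsto_fderiv_fderiv_of_isTypeIAncientMild_seq`, `cp` = `FrozenTop.cp`, `cp_isTest` = `FrozenTop.cp_isTest`, `cp_isDivFree` = `FrozenTop.cp_isDivFree`,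 `pairing_eq_of_weakEquilibrium` = `FrozenTop.pairing_eq_of_weakEquilibrium`, `slice_sub_const_of_pairing_eq` = `FrozenTop.slice_sub_const_of_pairing_eq`, `eq_zero_of_increments_const` = `FrozenTop.eq_zero_of_increments_const`, `eq_zero_of_weakEquilibrium` = `FrozenTop.eq_zero_of_weakEquilibrium`, `eq_zero_of_frozenVorticity` = `FrozenTop.eq_zero_of_frozenVorticity`, `tendsto_physicalTime` = `ColumnarTop.tendsto_physicalTime`, `eventually_fast` = `ColumnarTop.eventually_fast`, `sqrt_timeLag` = `StretchedTop.sqrt_timeLag`, `forall_of_forall_ne_zero` = `StretchedTop.forall_of_forall_ne_zero`, `radius_eq` = `FrozenTop.radius_eq`, `sing_of_not_bounded` = `InviscidTop.sing_of_not_bounded`, `exists_singularZoom_package₂` = `InviscidTop.exists_singularZoom_package₂`.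
-/

-- the summit and its single problem share the name `NavierStokesRegularity` (D-0017 nested layout)
set_option linter.dupNamespace false

noncomputable section

open MeasureTheory Set Function Filter TopologicalSpace Metric
open scoped Topology NNReal ENNReal InnerProductSpace RealInnerProductSpace Laplacian

namespace Summit.NavierStokesRegularity.NavierStokesRegularity.Theorems.ScenarioCensus.EquilibriumTop

open Literature.Analysis Literature.Analysis.FluidPDE
open Summit.NavierStokesRegularity.NavierStokesRegularity.Theorems

/-! ## §3 The `M`-normalised singular Type-I zoom package WITH HESSIANS -/

-- `exists_singularZoom_package₂`: the line restates the tree's `InviscidTop.exists_singularZoom_package₂`; taken BY NAME (gate lint dedup.landed).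

/-! ## §4 THE KILL: weak Eulerian equilibrium on every slice ⇒ `W ≡ 0` (time-direction rigidity of `𝒦`) -/

-- `cp`: the line restates the tree's `FrozenTop.cp`; taken BY NAME (gate lint dedup.landed).

-- `cp_isTest`: the line restates the tree's `FrozenTop.cp_isTest`; taken BY NAME (gate lint dedup.landed).

-- `cp_isDivFree`: the line restates the tree's `FrozenTop.cp_isDivFree`; taken BY NAME (gate lint dedup.landed).

-- `pairing_eq_of_weakEquilibrium`: the line restates the tree's `FrozenTop.pairing_eq_of_weakEquilibrium`; taken BY NAME (gate lint dedup.landed).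

-- `slice_sub_const_of_pairing_eq`: the line restates the tree's `FrozenTop.slice_sub_const_of_pairing_eq`; taken BY NAME (gate lint dedup.landed).

-- `eq_zero_of_increments_const`: the line restates the tree's `FrozenTop.eq_zero_of_increments_const`; taken BY NAME (gate lint dedup.landed).

-- `eq_zero_of_weakEquilibrium`: the line restates the tree's `FrozenTop.eq_zero_of_weakEquilibrium`; taken BY NAME (gate lint dedup.landed).

/-- **STEADY SLICES ⇒ TRIVIAL** (pointwise form with a pressure): if every slice of `W ∈ 𝒦_C` is a steady
unit-viscosity Navier–Stokes flow for SOME `C¹` pressure `q(s)`, `Δ W(s) − (W(s)·∇) W(s) = ∇q(s)`, then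
`W ≡ 0`.  (For a genuine ancient solution this says `∂ₛW ≡ 0`: steady `𝒦`-elements are trivial.) -/
theorem eq_zero_of_steadySlices {C : ℝ} {W : ℝ → E3 → E3} (hW : IsTypeIAncientMild C W)
    (h : ∀ s < (0 : ℝ), ∃ q : E3 → ℝ, ContDiff ℝ 1 q ∧
      ∀ y : E3, (Δ (W s)) y - convect (W s) (W s) y = gradient q y) :
    ∀ s < (0 : ℝ), ∀ y : E3, W s y = 0 := by
  refine FrozenTop.eq_zero_of_weakEquilibrium hW fun s hs g hg a c => ?_
  obtain ⟨q, hq, hqy⟩ := h s hs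
  have hΨ := FrozenTop.cp_isTest hg a c
  have hΨ1 : ContDiff ℝ 1 (FrozenTop.cp g a c) := hΨ.contDiff.of_le (by norm_cast)
  simp_rw [hqy]
  rw [integral_inner_gradient_eq_neg_integral_mul_divergence hq hΨ1 hΨ.hasCompactSupport]
  simp [FrozenTop.cp_isDivFree hg a c _]

/-- **EULERIAN EQUILIBRIUM ⇒ TRIVIAL**: `Δ W(s) = (W(s)·∇) W(s)` on every slice (pressureless steady
Navier–Stokes; for an ancient solution: `∂ₛW + ∇π ≡ 0`) ⇒ `W ≡ 0`. -/
theorem eq_zero_of_equilibrium {C : ℝ} {W : ℝ → E3 → E3} (hW : IsTypeIAncientMild C W)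
    (h : ∀ s < (0 : ℝ), ∀ y : E3, (Δ (W s)) y = convect (W s) (W s) y) :
    ∀ s < (0 : ℝ), ∀ y : E3, W s y = 0 :=
  eq_zero_of_steadySlices hW fun s hs => ⟨fun _ => 0, contDiff_const, fun y => by
    rw [h s hs y, sub_self]
    have hg : HasGradientAt (fun _ : E3 => (0 : ℝ)) (0 : E3) y := by
      have h0 := (hasFDerivAt_const (0 : ℝ) y).hasGradientAt
      simp only [map_zero] at h0
      exact h0
    exact hg.gradient.symm⟩

/-- **LAMB-BALANCED ⇒ TRIVIAL**: `Δ W(s) = ω(s) × W(s)` on every slice (for an ancient solution: the total head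
is frozen, `∂ₛW + ∇(π + |W|²/2) ≡ 0`) ⇒ `W ≡ 0` (Lamb identity `(W·∇)W = ω × W + ∇|W|²/2`). -/
theorem eq_zero_of_lambBalanced {C : ℝ} {W : ℝ → E3 → E3} (hW : IsTypeIAncientMild C W)
    (h : ∀ s < (0 : ℝ), ∀ y : E3, (Δ (W s)) y = cross (curl (W s) y) (W s y)) :
    ∀ s < (0 : ℝ), ∀ y : E3, W s y = 0 := by
  refine eq_zero_of_steadySlices hW fun s hs => ⟨fun y => -(‖W s y‖ ^ 2 / 2), ?_, fun y => ?_⟩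
  · exact (((hW.contDiff_slice hs).of_le (by norm_cast) : ContDiff ℝ 1 (W s)).norm_sq ℝ).div_const _ |>.neg
  · have hd : DifferentiableAt ℝ (W s) y := (hW.contDiff_slice hs).differentiable (by simp) y
    rw [h s hs y, convect_self_eq_cross_curl_add_gradient hd]
    have hg : gradient (fun z => -(‖W s z‖ ^ 2 / 2)) y = -gradient (fun z => ‖W s z‖ ^ 2 / 2) y := by
      rw [gradient, gradient, show (fun z => -(‖W s z‖ ^ 2 / 2)) = -(fun z => ‖W s z‖ ^ 2 / 2) from rfl,
        fderiv_neg, map_neg]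
    rw [hg]
    abel

-- `eq_zero_of_frozenVorticity`: the line restates the tree's `FrozenTop.eq_zero_of_frozenVorticity`; taken BY NAME (gate lint dedup.landed).

/-! ## §5 The joint compactness engine: exact Liouville ⇒ ε(M)-Liouville for weight-3 read-outs -/

/-- **COMPACTNESS UPGRADE, joint form (the engine).**  Let `R(v, L, H) ≥ 0` be a continuous read-out of
(value, gradient, Hessian), homogeneous of weight 3 under the `𝒦`-scaling `(v, L, H) ↦ (a v, a² L, a³ H)` (so that
`(−s)^{3/2} R(W, ∇W, ∇²W)(s, y)` is zoom-invariant).  If the EXACT Liouville theorem «`R(W, ∇W, ∇²W) ≡ 0 ⇒ W ≡ 0`»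
holds in `𝒦_M`, then ONE `ε = ε(M, R) > 0` works: `(−s)^{3/2} R ≤ ε` everywhere ⇒ `W ≡ 0`.  Proof: normalise a
bad sequence by census row A2a (`θ = 1/2`) and the zoom, extract a `C²_loc` limit in `𝒦_M` (tree `C¹_loc`
extraction + the Hessian upgrade of §2): it is nontrivial with `R ≡ 0`. -/
theorem exists_eps_liouville₃ (M : ℝ) {R : E3 → (E3 →L[ℝ] E3) → Hess → ℝ}
    (hRc : Continuous fun q : E3 × (E3 →L[ℝ] E3) × Hess => R q.1 q.2.1 q.2.2) (hR0 : ∀ v L H, 0 ≤ R v L H)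
    (hRh : ∀ a : ℝ, 0 < a → ∀ v L H, R (a • v) (a ^ 2 • L) (a ^ 3 • H) = a ^ 3 * R v L H)
    (hL : ∀ W : ℝ → E3 → E3, IsTypeIAncientMild M W →
      (∀ s < (0 : ℝ), ∀ y : E3, R (W s y) (fderiv ℝ (W s) y) (fderiv ℝ (fderiv ℝ (W s)) y) = 0) →
      ∀ s < (0 : ℝ), ∀ y : E3, W s y = 0) :
    ∃ ε : ℝ, 0 < ε ∧ ∀ W : ℝ → E3 → E3, IsTypeIAncientMild M W →
      (∀ s < (0 : ℝ), ∀ y : E3,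
        (-s) * Real.sqrt (-s) * R (W s y) (fderiv ℝ (W s) y) (fderiv ℝ (fderiv ℝ (W s)) y) ≤ ε) →
      ∀ s < (0 : ℝ), ∀ y : E3, W s y = 0 := by
  by_contra hcon
  have hseq : ∀ n : ℕ, ∃ W : ℝ → E3 → E3, IsTypeIAncientMild M W ∧
      (∀ s < (0 : ℝ), ∀ y : E3,
        (-s) * Real.sqrt (-s) * R (W s y) (fderiv ℝ (W s) y) (fderiv ℝ (fderiv ℝ (W s)) y) ≤
          1 / ((n : ℝ) + 1)) ∧
      ∃ s < (0 : ℝ), ∃ y : E3, W s y ≠ 0 := by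
    intro n
    by_contra h
    push Not at h
    exact hcon ⟨1 / ((n : ℝ) + 1), by positivity, h⟩
  choose W hW hD hnz using hseq
  -- ## (1) normalisation (census row A2a, `θ = 1/2`)
  have hbig : ∀ n, ∃ t < (0 : ℝ), ∃ x : E3, (1 / 2 : ℝ) / Real.sqrt (-t) < ‖W n t x‖ := by
    intro n
    by_contra hc
    push Not at hc
    have hhalf : IsTypeIAncientMild (1 / 2) (W n) :=
      ⟨(hW n).1, (hW n).2.1, (hW n).2.2.1, fun t ht x => hc t ht x⟩
    obtain ⟨s, hs, y, hy⟩ := hnz n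
    exact hy (ScenarioCensus.row_A2a_excluded (1 / 2) (by norm_num) (W n) hhalf s hs y)
  choose T hT X hX using hbig
  -- ## (2) zoom about `(T n, X n)` by `λ_n = √(-T n)`
  set lam : ℕ → ℝ := fun n => Real.sqrt (-T n) with hlam
  have hlam0 : ∀ n, 0 < lam n := fun n => Real.sqrt_pos.2 (neg_pos.2 (hT n))
  have hlam2 : ∀ n, lam n ^ 2 = -T n := fun n => Real.sq_sqrt (neg_pos.2 (hT n)).le
  set v : ℕ → ℝ → E3 → E3 := fun n => lam n • stPull (lam n ^ 2) (lam n) 0 (X n) (W n) with hv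
  have hvA : ∀ n, IsTypeIAncientMild M (v n) := fun n => isTypeIAncientMild_zoom (hW n) (hlam0 n) (X n)
  have hv_apply : ∀ n (s : ℝ) (y : E3), v n s y = lam n • W n (lam n ^ 2 * s) (X n + lam n • y) :=
    fun n s y => zoom_apply (lam n) (X n) (W n) s y
  have hv_fderiv : ∀ n, ∀ s < (0 : ℝ), ∀ y : E3,
      fderiv ℝ (v n s) y = (lam n ^ 2) • fderiv ℝ (W n (lam n ^ 2 * s)) (X n + lam n • y) := by
    intro n s hs y
    have hs' : lam n ^ 2 * s < 0 := mul_neg_of_pos_of_neg (pow_pos (hlam0 n) 2) hs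
    exact fderiv_zoom (X n) (W n) (((hW n).contDiff_slice hs').differentiable (by simp)) y
  have hv_hess : ∀ n (s : ℝ) (y : E3), fderiv ℝ (fderiv ℝ (v n s)) y =
      (lam n ^ 3) • fderiv ℝ (fderiv ℝ (W n (lam n ^ 2 * s))) (X n + lam n • y) :=
    fun n s y => InviscidTop.fderiv_fderiv_zoom (lam n) (X n) (W n) s y
  have hv_big : ∀ n, (1 / 2 : ℝ) < ‖v n (-1) 0‖ := by
    intro n
    rw [hv_apply, smul_zero, add_zero, mul_neg_one, hlam2, neg_neg, norm_smul, Real.norm_eq_abs,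
      abs_of_pos (hlam0 n)]
    have h := hX n
    rw [div_lt_iff₀ (hlam0 n)] at h
    linarith [mul_comm (lam n) ‖W n (T n) (X n)‖]
  have hv_def : ∀ n, ∀ s < (0 : ℝ), ∀ y : E3,
      (-s) * Real.sqrt (-s) * R (v n s y) (fderiv ℝ (v n s) y) (fderiv ℝ (fderiv ℝ (v n s)) y) ≤
        1 / ((n : ℝ) + 1) := by
    intro n s hs y
    have hs' : lam n ^ 2 * s < 0 := mul_neg_of_pos_of_neg (pow_pos (hlam0 n) 2) hs
    have key : ∀ Xr : ℝ, (-s) * Real.sqrt (-s) * (lam n ^ 3 * Xr) =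
        (-(lam n ^ 2 * s)) * Real.sqrt (-(lam n ^ 2 * s)) * Xr := by
      intro Xr
      rw [show -(lam n ^ 2 * s) = lam n ^ 2 * (-s) by ring, Real.sqrt_mul (sq_nonneg _),
        Real.sqrt_sq (hlam0 n).le]
      ring
    rw [hv_apply, hv_fderiv n s hs, hv_hess, hRh _ (hlam0 n), key]
    exact hD n _ hs' _
  -- ## (3) the `C²_loc` extraction in `𝒦_M`
  obtain ⟨φ, hφ, U, hU, hconv, hgrad, -, -⟩ := exists_tendsto_of_isTypeIAncientMild_seq M hvA
  have hhess := InviscidTop.tendsto_fderiv_fderiv_of_isTypeIAncientMild_seq (v := fun j => v (φ j))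
    (fun j => hvA (φ j)) hU hgrad
  have hφt : Tendsto φ atTop atTop := hφ.tendsto_atTop
  have hDU : ∀ s < (0 : ℝ), ∀ y : E3, R (U s y) (fderiv ℝ (U s) y) (fderiv ℝ (fderiv ℝ (U s)) y) = 0 := by
    intro s hs y
    have hj := (hconv s hs y).prodMk_nhds ((hgrad s hs y).prodMk_nhds (hhess s hs y))
    have hlimD : Tendsto (fun j => (-s) * Real.sqrt (-s) *
        R (v (φ j) s y) (fderiv ℝ (v (φ j) s) y) (fderiv ℝ (fderiv ℝ (v (φ j) s)) y)) atTop
        (𝓝 ((-s) * Real.sqrt (-s) * R (U s y) (fderiv ℝ (U s) y) (fderiv ℝ (fderiv ℝ (U s)) y))) :=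
      ((hRc.tendsto _).comp hj).const_mul _
    have hzero : Tendsto (fun j => 1 / ((φ j : ℝ) + 1)) atTop (𝓝 0) :=
      tendsto_one_div_add_atTop_nhds_zero_nat.comp hφt
    have hle : (-s) * Real.sqrt (-s) * R (U s y) (fderiv ℝ (U s) y) (fderiv ℝ (fderiv ℝ (U s)) y) ≤ 0 :=
      le_of_tendsto_of_tendsto hlimD hzero (Eventually.of_forall fun j => hv_def (φ j) s hs y)
    have hw : 0 < (-s) * Real.sqrt (-s) := mul_pos (neg_pos.2 hs) (Real.sqrt_pos.2 (neg_pos.2 hs))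
    have hn : R (U s y) (fderiv ℝ (U s) y) (fderiv ℝ (fderiv ℝ (U s)) y) ≤ 0 := by
      by_contra hpos
      push Not at hpos
      exact absurd hle (not_le.2 (mul_pos hw hpos))
    exact le_antisymm hn (hR0 _ _ _)
  have hUbig : (1 / 2 : ℝ) ≤ ‖U (-1) 0‖ :=
    ge_of_tendsto ((hconv (-1) (by norm_num) 0).norm) (Eventually.of_forall fun j => (hv_big (φ j)).le)
  have hU0 : U (-1) 0 = 0 := hL U hU hDU (-1) (by norm_num) 0
  rw [hU0, norm_zero] at hUbig
  linarith

/-- **ε-LIOUVILLE, almost-equilibrium** (new A-row, in kernel): ∀ M ∃ ε(M) > 0: `W ∈ 𝒦_M` with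
`(−s)^{3/2} ‖ΔW − (W·∇)W‖ ≤ ε` everywhere ⇒ `W ≡ 0`. -/
theorem exists_eps_liouville_equilibrium (M : ℝ) : ∃ ε : ℝ, 0 < ε ∧ ∀ W : ℝ → E3 → E3,
    IsTypeIAncientMild M W →
    (∀ s < (0 : ℝ), ∀ y : E3, (-s) * Real.sqrt (-s) * ‖(Δ (W s)) y - convect (W s) (W s) y‖ ≤ ε) →
    ∀ s < (0 : ℝ), ∀ y : E3, W s y = 0 := by
  obtain ⟨ε, hε, h⟩ := exists_eps_liouville₃ M (R := fun v L H => ‖eqOf v L H‖) continuous_eqOf.norm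
    (fun v L H => norm_nonneg _) (fun a ha v L H => by
      show ‖eqOf (a • v) (a ^ 2 • L) (a ^ 3 • H)‖ = a ^ 3 * ‖eqOf v L H‖
      rw [eqOf_smul, norm_smul, Real.norm_eq_abs, abs_of_pos (pow_pos ha 3)])
    (fun W hW h0 => eq_zero_of_equilibrium hW fun s hs y => sub_eq_zero.1 (by
      rw [laplacian_sub_convect_eq_eqOf]; exact norm_eq_zero.1 (h0 s hs y)))
  exact ⟨ε, hε, fun W hW hb => h W hW fun s hs y => by
    rw [← laplacian_sub_convect_eq_eqOf]; exact hb s hs y⟩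

/-- **ε-LIOUVILLE, almost-Lamb-balanced** (in kernel): ∀ M ∃ ε(M) > 0: `(−s)^{3/2} ‖ΔW − ω × W‖ ≤ ε`
everywhere ⇒ `W ≡ 0`. -/
theorem exists_eps_liouville_lamb (M : ℝ) : ∃ ε : ℝ, 0 < ε ∧ ∀ W : ℝ → E3 → E3,
    IsTypeIAncientMild M W →
    (∀ s < (0 : ℝ), ∀ y : E3, (-s) * Real.sqrt (-s) * ‖(Δ (W s)) y - cross (curl (W s) y) (W s y)‖ ≤ ε) →
    ∀ s < (0 : ℝ), ∀ y : E3, W s y = 0 := by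
  obtain ⟨ε, hε, h⟩ := exists_eps_liouville₃ M (R := fun v L H => ‖lambOf v L H‖) continuous_lambOf.norm
    (fun v L H => norm_nonneg _) (fun a ha v L H => by
      show ‖lambOf (a • v) (a ^ 2 • L) (a ^ 3 • H)‖ = a ^ 3 * ‖lambOf v L H‖
      rw [lambOf_smul, norm_smul, Real.norm_eq_abs, abs_of_pos (pow_pos ha 3)])
    (fun W hW h0 => eq_zero_of_lambBalanced hW fun s hs y => sub_eq_zero.1 (by
      rw [laplacian_sub_lamb_eq_lambOf]; exact norm_eq_zero.1 (h0 s hs y)))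
  exact ⟨ε, hε, fun W hW hb => h W hW fun s hs y => by
    rw [← laplacian_sub_lamb_eq_lambOf]; exact hb s hs y⟩

end Summit.NavierStokesRegularity.NavierStokesRegularity.Theorems.ScenarioCensus.EquilibriumTop

end
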